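import Summits.HubbardSuperconductivity.HubbardSuperconductivity.Theses.ChiralWindow
import Literature.MathematicalPhysics.QuantumLattice.HubbardRingPerronFrobeniusProofs
import Literature.MathematicalPhysics.QuantumLattice.HubbardWave0LiebProofs
import Literature.MathematicalPhysics.QuantumLattice.FinDimSpectrumProofs
import Literature.MathematicalPhysics.QuantumLattice.ApproximatingHamiltonianProofs
import Summits.HubbardSuperconductivity.HubbardSuperconductivity.Theorems.ChiralWindowCwThesisParticipationChebyshev
import Summits.HubbardSuperconductivity.HubbardSuperconductivity.Theorems.ChiralWindowCwThesisSectorGroundStateRestrict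
import Summits.HubbardSuperconductivity.HubbardSuperconductivity.Theorems.BalabanIRBirEveryGroundState
import HarnessLib

/-!
# Route `ChiralWindow`, crux `CwThesis` (stmt-HubbardSuperconductivity-10438): the ring-line reductions

Line `SketchIdeator2` (card `Cruxes/CwThesis/Ideas/participation-chebyshev-ring.md`, lead skeleton
`Cruxes/CwThesis/Lines/SketchIdeator2.lean`). This file records, sorry-free, the entry point through which the
crux `ChiralWindow.CwThesis` (`∃ U₀ > 0, ∀ U ∈ (0,U₀), ∃ δ ∈ [3/10,12/25]`, the summit matrix at `(U, δ)`) is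
closed by the line, so that the ONLY open content left is the weak-coupling engine (`stub_ringTraces`):

* `floor_of_ringTrace` — abstract, finite-dimensional: for Hermitian `H`, `X`, a centre `c`, a loss `θ` with
  `θc ≥ 0`, `β > 0` and the ring-trace bound `Re tr((X-c)² e^{-βH}) · Re Z(β) ≤ (θc)² · Re Z(2β)`, every
  normalised ground-state eigenvector `ψ` of `H` has `(1-θ)c ≤ Re⟨ψ, Xψ⟩` (the landed
  `stub_participationChebyshev`: participation-number Chebyshev);
* `ringFloor_of_ringTraceAt` — on the torus of side `L`: the ring-trace bound for the `(n,n)`-block compressions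
  `H_p`, `Q_p` of `hubbardTorus 2 L 1 U` and `Q = Δ_d†Δ_d` gives the floor `(1-θ)c ≤ Re⟨φ, Qφ⟩` for EVERY
  normalised ground state `φ` of the `(2n, S^z = 0)` sector (the landed `stub_sectorGroundStateRestrict`: a
  sector ground state restricts to a block ground eigenvector with the same norm and `Q`-expectation);
* `cwThesis_of_ringTraces` — C⁺ ⇒ X: the engine `RingTraces` (for every weak `U` a doping `δ_U` of the window
  and `κ, c > 0`, `θ ∈ [0,1)` with, eventually along `L = 2(k+1)`, the ring-trace bound on the `(n,n)` block at
  `β = κL` with centre `cL⁴`) gives `ChiralWindow.CwThesis` (floor `(1-θ)c·L⁴` for every sector ground state,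
  then `hasLRO_of_forall_groundState_bound`). This is the skeleton theorem `CwThesis_of` of the line with its
  engine stub `stub_ringTraces` as hypothesis (kept on one line: it is a registered stub signature).

All constants are quantified after `U` (Disproof.lean §6/§7: they must degenerate as `U → 0⁺`; the `U = 0`
analogue of the engine is refuted in `Theorems/CwThesis/Negative/RingTracesAtZero.lean`). Everything here is
finite-dimensional bookkeeping; no definition is introduced. Tasaki (2020) §2.1–2.2, App. A; Koma–Tasaki,
J. Stat. Phys. 76 (1994) §2; Scalapino, Phys. Rep. 250 (1995) §2 eq. (2.4).
-/

noncomputable section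

namespace Summit.HubbardSuperconductivity.HubbardSuperconductivity.Theorems.CwThesis

-- `Summit.HubbardSuperconductivity.HubbardSuperconductivity.…` repeats the summit name by design (D-0017 layout)
set_option linter.dupNamespace false
-- `DecidableEq {s : Finset (Orb Λ) // …}` (the `(n,n)`-block index) exceeds the default instance size budget
set_option synthInstance.maxSize 512

open Matrix Filter Literature.MathematicalPhysics.QuantumLattice Literature.Probability.LatticeModels
open Summit.HubbardSuperconductivity.HubbardSuperconductivity.Theses
open scoped ComplexOrder

/-! ### The abstract floor -/

/-- **Ring trace + Chebyshev ⇒ ground-state floor (abstract).** For Hermitian `H`, `X` on a finite index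
type, `β > 0`, a centre `c` and a loss `θ` with `θ·c ≥ 0`, and the ring-trace bound
`Re tr((X-c)·(X-c)·e^{-βH}) · Re Z(β) ≤ (θc)² · Re Z(2β)`, every normalised ground-state eigenvector `ψ` of
`H` (`Hψ = E₀ψ`) has `(1-θ)·c ≤ Re⟨ψ, Xψ⟩`: by `stub_participationChebyshev`,
`Re⟨ψ,Xψ⟩ ≥ c - √(Re tr((X-c)²e^{-βH}) · Re Z(β) / Re Z(2β)) ≥ c - √((θc)²) = c - θc` (`Re Z(2β) > 0` on the
nonempty index type carrying the unit vector `ψ`). [folklore] -/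
theorem floor_of_ringTrace {m : Type*} [Fintype m] [DecidableEq m]
    (H X : Matrix m m ℂ) (hH : H.IsHermitian) (hX : X.IsHermitian) {β c θ : ℝ} (hβ : 0 < β)
    (hθc : 0 ≤ θ * c)
    (hring : ((X - (c : ℂ) • 1) * (X - (c : ℂ) • 1) * Matrix.gibbsWeight β H).trace.re *
        (Matrix.partitionFn β H).re ≤ (θ * c) ^ 2 * (Matrix.partitionFn (2 * β) H).re)
    (ψ : m → ℂ) (hψ : star ψ ⬝ᵥ ψ = 1) (hHψ : H *ᵥ ψ = ((H.groundEnergy : ℝ) : ℂ) • ψ) :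
    (1 - θ) * c ≤ (star ψ ⬝ᵥ X *ᵥ ψ).re := by
  have hcheb := stub_participationChebyshev H X hH hX hβ c ψ hψ hHψ
  -- the index type is nonempty since `ψ` is a unit vector
  rcases isEmpty_or_nonempty m with hm | hm
  · exfalso
    have : star ψ ⬝ᵥ ψ = 0 := by simp [dotProduct]
    rw [this] at hψ
    exact zero_ne_one hψ
  have hZ2 : 0 < (Matrix.partitionFn (2 * β) H).re := partitionFn_re_pos hH (2 * β)
  have hquot : ((X - (c : ℂ) • 1) * (X - (c : ℂ) • 1) * Matrix.gibbsWeight β H).trace.re *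
      (Matrix.partitionFn β H).re / (Matrix.partitionFn (2 * β) H).re ≤ (θ * c) ^ 2 := by
    rw [div_le_iff₀ hZ2]
    exact hring
  have hsqrt : Real.sqrt (((X - (c : ℂ) • 1) * (X - (c : ℂ) • 1) * Matrix.gibbsWeight β H).trace.re *
      (Matrix.partitionFn β H).re / (Matrix.partitionFn (2 * β) H).re) ≤ θ * c := by
    calc Real.sqrt _ ≤ Real.sqrt ((θ * c) ^ 2) := Real.sqrt_le_sqrt hquot
      _ = θ * c := Real.sqrt_sq hθc
  linarith

/-! ### The floor on the torus: every sector ground state -/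

/-- **Ring trace on the `(n,n)` block ⇒ floor for every sector ground state.** On the fermionic torus of side
`L`, for `n ≤ L²`, any coupling `U`, `β > 0`, a centre `c` and a loss `θ` with `θc ≥ 0`: if the compressions
`H_p`, `Q_p` of `H = hubbardTorus 2 L 1 U` and `Q = Δ_d†Δ_d = (pairField dWaveFormFactor L)ᴴ pairField …` to
Lieb's `(n,n)` occupation sector satisfy the ring-trace bound
`Re tr((Q_p - c)² e^{-βH_p}) · Re Z_β(H_p) ≤ (θc)² · Re Z_{2β}(H_p)`, then EVERY normalised ground state `φ` of
`H` in the joint sector `(2n, S^z = 0)` has `(1-θ)c ≤ Re⟨φ, Qφ⟩` (`stub_sectorGroundStateRestrict` moves `φ` to a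
block ground eigenvector with the same norm and `Q`-expectation; `floor_of_ringTrace` on the block). [folklore] -/
theorem ringFloor_of_ringTraceAt (L : ℕ) [NeZero L] (U : ℝ) {n : ℕ} (hn : n ≤ L ^ 2) {β c θ : ℝ} (hβ : 0 < β)
    (hθc : 0 ≤ θ * c)
    (hring : ((((pairField dWaveFormFactor L)ᴴ * pairField dWaveFormFactor L).toBlock
          (fun s => (upPart s).card = n ∧ (downPart s).card = n)
          (fun s => (upPart s).card = n ∧ (downPart s).card = n) - (c : ℂ) • 1) *
        (((pairField dWaveFormFactor L)ᴴ * pairField dWaveFormFactor L).toBlock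
          (fun s => (upPart s).card = n ∧ (downPart s).card = n)
          (fun s => (upPart s).card = n ∧ (downPart s).card = n) - (c : ℂ) • 1) *
        Matrix.gibbsWeight β ((hubbardTorus 2 L 1 U).toBlock
          (fun s => (upPart s).card = n ∧ (downPart s).card = n)
          (fun s => (upPart s).card = n ∧ (downPart s).card = n))).trace.re *
      (Matrix.partitionFn β ((hubbardTorus 2 L 1 U).toBlock
          (fun s => (upPart s).card = n ∧ (downPart s).card = n)
          (fun s => (upPart s).card = n ∧ (downPart s).card = n))).re ≤
      (θ * c) ^ 2 * (Matrix.partitionFn (2 * β) ((hubbardTorus 2 L 1 U).toBlock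
          (fun s => (upPart s).card = n ∧ (downPart s).card = n)
          (fun s => (upPart s).card = n ∧ (downPart s).card = n))).re)
    (φ : Fock (Orb (FermionTorus 2 L))) (hgs : IsGroundStateInSector (hubbardTorus 2 L 1 U) (2 * n) 0 φ)
    (hunit : star φ ⬝ᵥ φ = 1) :
    (1 - θ) * c ≤
      (star φ ⬝ᵥ ((pairField dWaveFormFactor L)ᴴ * pairField dWaveFormFactor L) *ᵥ φ).re := by
  set H := hubbardTorus 2 L 1 U with hH_def
  set Q : Matrix (Finset (Orb (FermionTorus 2 L))) (Finset (Orb (FermionTorus 2 L))) ℂ :=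
    (pairField dWaveFormFactor L)ᴴ * pairField dWaveFormFactor L with hQ_def
  have hH : H.IsHermitian := hubbardTorus_isHermitian (hamiltonian_isHermitian_and_commute_holds _) 1 U
  have hQ : Q.IsHermitian := isHermitian_conjTranspose_mul_self _
  -- restrict the sector ground state to the `(n,n)` block
  obtain ⟨hnorm, hexp, heig⟩ := stub_sectorGroundStateRestrict L hn H Q hH φ hgs
  set φp : {s : Finset (Orb (FermionTorus 2 L)) // (upPart s).card = n ∧ (downPart s).card = n} → ℂ :=
    fun s => φ s.1 with hφp_def
  set Hp := H.toBlock (fun s => (upPart s).card = n ∧ (downPart s).card = n)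
      (fun s => (upPart s).card = n ∧ (downPart s).card = n) with hHp_def
  set Qp := Q.toBlock (fun s => (upPart s).card = n ∧ (downPart s).card = n)
      (fun s => (upPart s).card = n ∧ (downPart s).card = n) with hQp_def
  have hHp : Hp.IsHermitian := hH.submatrix _
  have hQp : Qp.IsHermitian := hQ.submatrix _
  have hunitp : star φp ⬝ᵥ φp = 1 := by rw [hnorm, hunit]
  have hfloor := floor_of_ringTrace Hp Qp hHp hQp hβ hθc hring φp hunitp heig
  rwa [hexp] at hfloor

/-! ### C⁺ ⇒ X: the engine closes the crux -/

/-- **Ring traces at one `(U, δ)` ⇒ the summit matrix at `(U, δ)`.** Fix `U` and `δ ≥ 0`. If there are a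
temperature slope `κ > 0`, a centre `c > 0` and a loss `θ ∈ [0,1)` such that, eventually along the even sides
`L = 2(k+1)`, the `(n,n)`-block compressions `H_p`, `Q_p` of `hubbardTorus 2 L 1 U` and `Δ_d†Δ_d`
(`2n = N_L(δ) = 2⌊(1-δ)L²/2⌋`) satisfy the ring-trace bound
`Re tr((Q_p - cL⁴)² e^{-κL H_p}) · Re Z_{κL}(H_p) ≤ (θcL⁴)² · Re Z_{2κL}(H_p)`, then every admissible sequence of
normalised `(N_L, S^z = 0)`-sector ground states has `d_{x²-y²}` pair-field long-range order along the even sides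
(`ringFloor_of_ringTraceAt` gives the floor `(1-θ)c·L⁴` for every sector ground state at every large even side;
`hasLRO_of_forall_groundState_bound`). The conclusion is word for word the summit matrix at `(U, δ)`. [folklore] -/
theorem matrix_of_ringTracesAt (U δ : ℝ) (hδ : 0 ≤ δ)
    (h : ∃ κ c θ : ℝ, 0 < κ ∧ 0 < c ∧ 0 ≤ θ ∧ θ < 1 ∧ ∀ᶠ k : ℕ in atTop,
      let L : ℕ := 2 * (k + 1)
      let n : ℕ := ⌊(1 - δ) * (L : ℝ) ^ 2 / 2⌋₊
      let Hp := (hubbardTorus 2 L 1 U).toBlock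
        (fun s => (upPart s).card = n ∧ (downPart s).card = n)
        (fun s => (upPart s).card = n ∧ (downPart s).card = n)
      let Qp := ((pairField dWaveFormFactor L)ᴴ * pairField dWaveFormFactor L).toBlock
        (fun s => (upPart s).card = n ∧ (downPart s).card = n)
        (fun s => (upPart s).card = n ∧ (downPart s).card = n)
      let D := Qp - ((c * (L : ℝ) ^ 4 : ℝ) : ℂ) • 1
      (D * D * Matrix.gibbsWeight (κ * (L : ℝ)) Hp).trace.re *
          (Matrix.partitionFn (κ * (L : ℝ)) Hp).re ≤
        (θ * c * (L : ℝ) ^ 4) ^ 2 * (Matrix.partitionFn (2 * (κ * (L : ℝ))) Hp).re)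
    (N : ℕ → ℕ) (ψ : ∀ L, Fock (Orb (FermionTorus 2 L)))
    (hadm : ∀ L, Even L → N L = 2 * ⌊(1 - δ) * (L : ℝ) ^ 2 / 2⌋₊ ∧ star (ψ L) ⬝ᵥ ψ L = 1 ∧
      IsGroundStateInSector (hubbardTorus 2 L 1 U) (N L) 0 (ψ L)) :
    HasLongRangeOrder (fun k => halfOpenBox 2 (2 * k))
      (fun k => torusPullback (pairFieldCorr dWaveFormFactor ψ) (2 * k)) := by
  obtain ⟨κ, c, θ, hκ, hc, hθ, hθ1, hev⟩ := h
  obtain ⟨k₀, hk₀⟩ := Filter.eventually_atTop.1 hev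
  have hfloorpos : 0 < (1 - θ) * c := mul_pos (by linarith) hc
  refine hasLRO_of_forall_groundState_bound U δ ((1 - θ) * c) hfloorpos (2 * (k₀ + 1)) ?_ N ψ hadm
  intro L _ hL hLe φ hgs hunit
  -- write the even side as `L = 2(k+1)` with `k ≥ k₀`
  obtain ⟨r, hr⟩ := hLe
  obtain ⟨k, hk, rfl⟩ : ∃ k, k₀ ≤ k ∧ L = 2 * (k + 1) := ⟨r - 1, by omega, by omega⟩
  have hring := hk₀ k hk
  dsimp only at hring
  -- `n ≤ L²`
  have hn : ⌊(1 - δ) * (((2 * (k + 1) : ℕ)) : ℝ) ^ 2 / 2⌋₊ ≤ (2 * (k + 1)) ^ 2 := by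
    have hx : (1 - δ) * (((2 * (k + 1) : ℕ)) : ℝ) ^ 2 / 2 ≤ (((2 * (k + 1)) ^ 2 : ℕ) : ℝ) := by
      push_cast
      nlinarith [sq_nonneg (((2 * (k + 1) : ℕ)) : ℝ)]
    exact (Nat.floor_mono hx).trans (Nat.floor_natCast _).le
  have hβ : 0 < κ * (((2 * (k + 1) : ℕ)) : ℝ) := by positivity
  have hθcL : 0 ≤ θ * (c * (((2 * (k + 1) : ℕ)) : ℝ) ^ 4) := by positivity
  -- the ring bound with centre `c L⁴`, in the shape of `ringFloor_of_ringTraceAt`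
  rw [show θ * c * (((2 * (k + 1) : ℕ)) : ℝ) ^ 4 = θ * (c * (((2 * (k + 1) : ℕ)) : ℝ) ^ 4) by ring] at hring
  have hfloor := ringFloor_of_ringTraceAt (2 * (k + 1)) U hn hβ hθcL hring φ hgs hunit
  calc (1 - θ) * c * (((2 * (k + 1) : ℕ)) : ℝ) ^ 4 = (1 - θ) * (c * (((2 * (k + 1) : ℕ)) : ℝ) ^ 4) := by ring
    _ ≤ _ := hfloor

/-- **Ring traces ⇒ the crux (C⁺ ⇒ X).** If for every weak `U` there are a doping `δ_U ∈ [3/10, 12/25]`,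
a temperature slope `κ > 0`, a centre `c > 0` and a loss `θ ∈ [0,1)` such that, eventually along the even sides
`L = 2(k+1)`, the `(n,n)`-block compressions `H_p`, `Q_p` of `hubbardTorus 2 L 1 U` and `Δ_d†Δ_d` (`2n = N_L(δ_U)`)
satisfy the ring-trace bound `Re tr((Q_p - cL⁴)² e^{-κL H_p}) · Re Z_{κL}(H_p) ≤ (θcL⁴)² · Re Z_{2κL}(H_p)`, then
`ChiralWindow.CwThesis` (`matrix_of_ringTracesAt` at `(U, δ_U)`, `δ_U ≥ 3/10 ≥ 0`). This is the skeleton theorem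
`CwThesis_of` of line `SketchIdeator2` with its engine stub `stub_ringTraces` as hypothesis. (The statement is kept
on one line: it is the registered stub signature, matched textually by the gate.) [folklore] -/
theorem cwThesis_of_ringTraces : (∃ U₀ : ℝ, 0 < U₀ ∧ ∀ U ∈ Set.Ioo (0:ℝ) U₀, ∃ δ ∈ Set.Icc (3/10 : ℝ) (12/25), ∃ κ c θ : ℝ, 0 < κ ∧ 0 < c ∧ 0 ≤ θ ∧ θ < 1 ∧ ∀ᶠ k : ℕ in atTop, let L : ℕ := 2 * (k + 1); let n : ℕ := ⌊(1 - δ) * (L : ℝ) ^ 2 / 2⌋₊; let Hp := (hubbardTorus 2 L 1 U).toBlock (fun s => (upPart s).card = n ∧ (downPart s).card = n) (fun s => (upPart s).card = n ∧ (downPart s).card = n); let Qp := ((pairField dWaveFormFactor L)ᴴ * pairField dWaveFormFactor L).toBlock (fun s => (upPart s).card = n ∧ (downPart s).card = n) (fun s => (upPart s).card = n ∧ (downPart s).card = n); let D := Qp - ((c * (L : ℝ) ^ 4 : ℝ) : ℂ) • 1; (D * D * Matrix.gibbsWeight (κ * (L : ℝ)) Hp).trace.re * (Matrix.partitionFn (κ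 * (L : ℝ)) Hp).re ≤ (θ * c * (L : ℝ) ^ 4) ^ 2 * (Matrix.partitionFn (2 * (κ * (L : ℝ))) Hp).re) → ChiralWindow.CwThesis := by
  rintro ⟨U₀, hU₀, hU⟩
  refine ⟨U₀, hU₀, fun U hUm => ?_⟩
  obtain ⟨δ, hδ, h⟩ := hU U hUm
  exact ⟨δ, hδ, matrix_of_ringTracesAt U δ (by linarith [hδ.1]) h⟩

end Summit.HubbardSuperconductivity.HubbardSuperconductivity.Theorems.CwThesis

end
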